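import Summits.HubbardSuperconductivity.HubbardLadder.LiebGramRows
import Literature.MathematicalPhysics.QuantumLattice.HubbardSpinReflectionSignRule
import HarnessLib

/-!
# Certificate rows with Shen–Qiu–Tian SIGN-RULE terms (`signrule`) on the even half-filled torus, I:
# the sign-rule sum, masters, energy rows

HONEST FRAMING: first certified bounds; not a superconductivity verdict; every number certified or labelled float.

Rows part of the M2 vocabulary (unit sr-mbsolver-m2-4; the sign-rule edge asked for by sr-mbsolver-m2-3,
HOME/INBOX 2026-08-21T09:49Z, whose ground-state-constraint census found published `4 × 4` window
optima for the `S(π,π)` floor violating the sign rule on 10–11 of 15 shells). Sibling of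
`Summits/HubbardSuperconductivity/HubbardLadder/LiebGramRows.lean` (Lieb Gram blocks) and
`…/HubbardSingletRows.lean` (singlet menu): solver-side row menu for certificate files at half filling,
`n = 1`, on `hubbardTorus 2 L t U`, `L` even, `t ≠ 0`, `U > 0`. Part II (window rows R2, both
directions) is `Rows/HalfFilledTorusSignRuleWindowRows.lean`.

The Literature file `HubbardSpinReflectionSignRule` proves (Shen–Qiu–Tian 1994; Tian 2004 §3; from
Lieb's spin-reflection positivity 1989) that in THE half-filled ground state `ψ` (unique, a singlet)
every spin correlation obeys the SIGN RULE `ε_x ε_y ⟨ψ, 𝐒_x·𝐒_y ψ⟩ ≥ 0`, `ε_x = (-1)^{x₁+x₂}`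
(`stagSign_mul_expect_fermionSpinDot_nonneg`). Hence for multipliers `ν_r ≥ 0` and site pairs
`(x_r, y_r)` the SIGN-RULE SUM `Σ_r ν_r · (ε_{x_r} ε_{y_r}) • 𝐒_{x_r}·𝐒_{y_r}` (`ε = torusSign`, the
`ε` of the `liebgram` Shiba words; `torusSign_eq_stagSign`) has nonnegative ground-state expectation
(`hubbardTorus_re_expect_signRuleSum_nonneg`) and may be put on the nonnegative side of a certificate
identity like an SOS Gram form or a Lieb form — although, unlike those, it is NOT a positive
operator: only its value in THE ground state is signed (these rows bound ground-state quantities only,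
which is all the M2 table uses). A translation-summed shell row `ν_r ε_r Σ_x 𝐒_x·𝐒_{x+r}` is the
case `ρ = shells × sites`.

Rows (shape of `LiebGramRows`; menu `singletSectorAnn (L²) = ![N̂ − L², S^z, S⁺, (S⁺)ᴴ]`, residual
`R + δ·1 ⪰ 0`):
* MASTERS over an abstract term `P` whose one hypothesis is `0 ≤ Re ⟨φ, P φ⟩` for every half-filled
  eigenvector `φ` at the ground energy: R1 `groundEnergyAt_halfFilling_ge_of_certificate_gsNonneg`
  (`H − c·1 = SOS + null + (P + R)` ⟹ `c − δ ≤ E₀(L²)`) and R2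
  `re_expect_halfFilledGS_ge_of_windowCertificate_gsNonneg` (`V − c·1 = SOS + null + μ (E_up − H)
  + ν (H − E_lo) + (P + R)`, `μ, ν ≥ 0`, `E_lo ≤ E₀(L²) ≤ E_up` ⟹ `c − δ ≤ Re ⟨ψ, V ψ⟩` for every
  normalised `(L², S^z = 0)` sector ground state `ψ`);
* R1 instances `groundEnergyAt_halfFilling_ge_of_certificate_signRule` (`P` = sign-rule sum) and
  `…_liebGram_signRule` (`P` = both Lieb forms + sign-rule sum).

NOTE for certificate files at the concrete torus (as in `LiebGramRows`): elaborate the identity with the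
order-derived `DecidableEq (FermionTorus 2 L)` (`LinearOrder.toDecidableEq`, the local instance of this
file), the instance all orbital-generic lemmas carry.

References: [cite: ShenQiuTian1994, Theorem and eqs. (7)–(9)]; [cite: Tian2004, §3];
[cite: LiebPRL1989, proof of Theorem 2]; [cite: KullEtAl2024, §5.3]; [cite: WangEtAl2024, §3 eq. (4)];
[cite: Han2020Bootstrap, §2 eq. (3)].
-/

noncomputable section

namespace Summit.Ventures.CertifiedManyBodySolver

open Matrix Finset Literature.MathematicalPhysics.QuantumLattice
  Literature.MathematicalPhysics.QuantumLattice.LiebTwo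
  Literature.MathematicalPhysics.QuantumLattice.FermionSpinMoment
  Literature.MathematicalPhysics.QuantumManyBody.StateRelaxation
  Summit.HubbardSuperconductivity.HubbardLadder
open scoped ComplexOrder MatrixOrder

/-- The vector state of `StateRelaxationDuality` under an unambiguous local name. -/
local notation "srState" => Literature.MathematicalPhysics.QuantumManyBody.StateRelaxation.vectorState

/-- Unfolding `srState`. [folklore] -/
private theorem srState_apply {n : Type*} [Fintype n] (v : n → ℂ) (O : Matrix n n ℂ) :
    srState v O = star v ⬝ᵥ O *ᵥ v := rfl

/-- `-δ ≤ Re ⟨v, R v⟩` for `R + δ·1 ⪰ 0` and a unit vector `v`. [folklore] -/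
private theorem re_srState_ge_of_posSemidef_add {n : Type*} [Fintype n] [DecidableEq n]
    {v : n → ℂ} (hv : star v ⬝ᵥ v = 1) {R : Matrix n n ℂ} {δ : ℝ}
    (hR : (R + (δ : ℂ) • (1 : Matrix n n ℂ)).PosSemidef) : -δ ≤ (srState v R).re := by
  have h := hR.dotProduct_mulVec_nonneg v
  rw [add_mulVec, dotProduct_add, Matrix.smul_mulVec, one_mulVec, dotProduct_smul, hv,
    smul_eq_mul, mul_one] at h
  obtain ⟨hre, -⟩ := Complex.nonneg_iff.mp h
  rw [Complex.add_re, Complex.ofReal_re] at hre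
  rw [srState_apply]; linarith

section Torus

variable (L : ℕ) [NeZero L]

/-- (Local to this file, as in `LiebGramRows` / `HubbardTorusLocalCertificate`.) Equality of torus
sites is decided through the LINEAR ORDER. No library instance is overridden outside this file.
[folklore] -/
local instance (priority := high) instDecidableEqFermionTorusSignRuleRows :
    DecidableEq (FermionTorus 2 L) :=
  LinearOrder.toDecidableEq

variable {m : Type*} [Fintype m] [DecidableEq m]

omit [NeZero L] in
/-- `|(ℤ/Lℤ)²| = L²`. [folklore] -/
private theorem card_fermionTorus_sq : Fintype.card (FermionTorus 2 L) = L ^ 2 := by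
  simp only [FermionTorus, Fintype.card_lex, Fintype.card_fun, Fintype.card_fin]

omit [NeZero L] in
/-- The `liebgram` sign `torusSign x = (-1)^{x₁+x₂}` IS the Shen–Qiu–Tian sublattice sign `stagSign A x`
of `A = {ε = +1}`. [cite: ShenQiuTian1994, Theorem and eqs. (7)–(9)] -/
theorem torusSign_eq_stagSign (z : FermionTorus 2 L) :
    torusSign z = stagSign (univ.filter fun z : FermionTorus 2 L => torusStagger z = 1) z := by
  simp only [torusSign, stagSign, Finset.mem_filter, Finset.mem_univ, true_and]
  rcases Int.units_eq_one_or (torusStagger z) with hz | hz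
  · rw [if_pos hz, hz]; simp
  · rw [if_neg (by rw [hz]; decide), hz]; simp

omit [NeZero L] in
/-- The null part of a row evaluated in a half-filled singlet eigenvector vanishes: commutators with
`H`, menu ideal terms (as in `LiebGramRows`). [folklore] -/
private theorem srState_null_eq_zero {t U : ℝ} {ψ : Fock (Orb (FermionTorus 2 L))}
    (hN : IsNParticle (L ^ 2) ψ) (hS : spinSq *ᵥ ψ = 0)
    (hHψ : hubbardTorus 2 L t U *ᵥ ψ =
      ((groundEnergyAt (fermionTorusGraph 2 L) t U (L ^ 2) : ℝ) : ℂ) • ψ)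
    {κ : Type*} (s : Finset κ)
    (X : κ → Matrix (Finset (Orb (FermionTorus 2 L))) (Finset (Orb (FermionTorus 2 L))) ℂ)
    {ι : Type*} (t' : Finset ι)
    (Y Y' : ι → Matrix (Finset (Orb (FermionTorus 2 L))) (Finset (Orb (FermionTorus 2 L))) ℂ)
    (a a' : ι → Fin 4) :
    srState ψ (∑ k ∈ s, (hubbardTorus 2 L t U * X k - X k * hubbardTorus 2 L t U) +
        ∑ q ∈ t', (Y q * singletSectorAnn (L ^ 2) (a q) + singletSectorAnn (L ^ 2) (a' q) * Y' q)) =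
      0 := by
  have hHerm : (hubbardTorus 2 L t U).IsHermitian :=
    LiebThm1.hamiltonian_isHermitian (fermionTorusGraph 2 L) t U
  have h1 : ∀ k ∈ s, srState ψ (hubbardTorus 2 L t U * X k - X k * hubbardTorus 2 L t U) = 0 :=
    fun k _ => vectorState_commutator hHerm hHψ (X k)
  have h2 : ∀ q ∈ t',
      srState ψ (Y q * singletSectorAnn (L ^ 2) (a q) + singletSectorAnn (L ^ 2) (a' q) * Y' q) =
        0 := fun q _ => by
    rw [map_add, vectorState_mul_of_mulVec_eq_zero ψ (Y q)
        (singletSectorAnn_mulVec_eq_zero (L ^ 2) hN hS (a q)),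
      vectorState_mul_of_conjTranspose_mulVec_eq_zero ψ (Y' q)
        (conjTranspose_singletSectorAnn_mulVec_eq_zero (L ^ 2) hN hS (a' q)), add_zero]
  rw [map_add, map_sum, map_sum, Finset.sum_eq_zero h1, Finset.sum_eq_zero h2, add_zero]

/-! ## §1 The sign-rule sum is nonnegative in THE half-filled ground state -/

/-- **Sign-rule rows**: for multipliers `ν_r ≥ 0` and site pairs `(x_r, y_r)`, the sum
`Σ_r ν_r · (ε_{x_r} ε_{y_r}) • 𝐒_{x_r}·𝐒_{y_r}` has nonnegative expectation in every half-filled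
eigenvector at the ground energy of `hubbardTorus 2 L t U` (`L` even, `t ≠ 0`, `U > 0`) — the
Shen–Qiu–Tian sign rule with SU(2) isotropy of the (unique, singlet) ground state.
[cite: ShenQiuTian1994, Theorem and eqs. (7)–(9)] [cite: Tian2004, §3] [cite: LiebPRL1989, proof of Theorem 2] -/
theorem hubbardTorus_re_expect_signRuleSum_nonneg (hL : Even L) {t U : ℝ} (ht : t ≠ 0) (hU : 0 < U)
    {ψ : Fock (Orb (FermionTorus 2 L))} (hN : IsNParticle (L ^ 2) ψ)
    (hHψ : hubbardTorus 2 L t U *ᵥ ψ =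
      ((groundEnergyAt (fermionTorusGraph 2 L) t U (L ^ 2) : ℝ) : ℂ) • ψ)
    {ρ : Type*} (sr : Finset ρ) {νs : ρ → ℝ} (hνs : ∀ r ∈ sr, 0 ≤ νs r)
    (x y : ρ → FermionTorus 2 L) :
    0 ≤ (star ψ ⬝ᵥ (∑ r ∈ sr, ((νs r : ℝ) : ℂ) •
        ((torusSign (x r) * torusSign (y r)) • fermionSpinDot (x r) (y r))) *ᵥ ψ).re := by
  obtain ⟨hG, hA, h2, -⟩ := LiebHalfFilled.hubbardTorus_lieb_hypotheses (L := L) hL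
  have hcard := LiebHalfFilled.compl_card_eq_card_of_two_mul h2
  have hN' := hN
  have hHψ' := hHψ
  rw [← card_fermionTorus_sq L] at hN' hHψ'
  show 0 ≤ (srState ψ (∑ r ∈ sr, ((νs r : ℝ) : ℂ) •
    ((torusSign (x r) * torusSign (y r)) • fermionSpinDot (x r) (y r)))).re
  rw [map_sum, Complex.re_sum]
  refine Finset.sum_nonneg fun r hr => ?_
  have h := stagSign_mul_expect_fermionSpinDot_nonneg hG _ hA hcard ht hU hN' hHψ' (x r) (y r)
  rw [← torusSign_eq_stagSign L, ← torusSign_eq_stagSign L] at h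
  obtain ⟨hre, -⟩ := Complex.nonneg_iff.mp h
  rw [map_smul, map_smul, smul_eq_mul, smul_eq_mul, srState_apply, Complex.re_ofReal_mul]
  exact mul_nonneg (hνs r hr) hre

/-- Lieb forms (`G, G' ⪰ 0`) AND a sign-rule sum together: nonnegative ground-state expectation.
[cite: LiebPRL1989, proof of Theorem 2] [cite: ShenQiuTian1994, Theorem and eqs. (7)–(9)] [cite: KullEtAl2024, §5.3] -/
theorem hubbardTorus_re_expect_liebForms_add_signRuleSum_nonneg (hL : Even L) {t U : ℝ} (ht : t ≠ 0)
    (hU : 0 < U) {ψ : Fock (Orb (FermionTorus 2 L))} (hN : IsNParticle (L ^ 2) ψ)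
    (hHψ : hubbardTorus 2 L t U *ᵥ ψ =
      ((groundEnergyAt (fermionTorusGraph 2 L) t U (L ^ 2) : ℝ) : ℂ) • ψ)
    {κ₁ : Type*} [Fintype κ₁] {Gm : Matrix κ₁ κ₁ ℂ} (hGm : Gm.PosSemidef)
    (w : κ₁ → List (FermionTorus 2 L × FermionTorus 2 L))
    {κ₂ : Type*} [Fintype κ₂] {Gm' : Matrix κ₂ κ₂ ℂ} (hGm' : Gm'.PosSemidef)
    (w' : κ₂ → List (FermionTorus 2 L × FermionTorus 2 L))
    {ρ : Type*} (sr : Finset ρ) {νs : ρ → ℝ} (hνs : ∀ r ∈ sr, 0 ≤ νs r)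
    (x y : ρ → FermionTorus 2 L) :
    0 ≤ (star ψ ⬝ᵥ (liebForm torusSign Gm w + liebFormFlip torusSign Gm' w' +
        ∑ r ∈ sr, ((νs r : ℝ) : ℂ) •
          ((torusSign (x r) * torusSign (y r)) • fermionSpinDot (x r) (y r))) *ᵥ ψ).re := by
  rw [add_mulVec, add_mulVec, dotProduct_add, dotProduct_add, Complex.add_re, Complex.add_re]
  exact add_nonneg (add_nonneg
    (Complex.nonneg_iff.mp (hubbardTorus_liebForm_expect_nonneg hL ht hU hN hHψ hGm w)).1
    (Complex.nonneg_iff.mp (hubbardTorus_liebFormFlip_expect_nonneg hL ht hU hN hHψ hGm' w')).1)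
    (hubbardTorus_re_expect_signRuleSum_nonneg L hL ht hU hN hHψ sr hνs x y)

/-! ## §2 Masters: an abstract ground-state-nonnegative term `P` on the nonnegative side -/

/-- **Energy row, abstract ground-state-nonnegative term (R1 master at `n = 1`).** For even `L`,
`t ≠ 0`, `U > 0`: an identity `H − c·1 = Σ Λᵢⱼ Oᵢᴴ Oⱼ + null + (P + R)` with `Λ ⪰ 0`, the null terms of
`LiebGramRows` (commutators with `H`, menu `singletSectorAnn (L²)`), `R + δ·1 ⪰ 0` and ANY `P` whose
expectation is `≥ 0` in every half-filled eigenvector at the ground energy proves `c − δ ≤ E₀(L²)`.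
[cite: LiebPRL1989, proof of Theorem 2] [cite: KullEtAl2024, §5.3] [cite: Han2020Bootstrap, §2 eq. (3)] -/
theorem groundEnergyAt_halfFilling_ge_of_certificate_gsNonneg (hL : Even L) {t U : ℝ} (ht : t ≠ 0)
    (hU : 0 < U) {Λm : Matrix m m ℂ} (hΛ : Λm.PosSemidef)
    (O : m → Matrix (Finset (Orb (FermionTorus 2 L))) (Finset (Orb (FermionTorus 2 L))) ℂ)
    {κ : Type*} (s : Finset κ)
    (X : κ → Matrix (Finset (Orb (FermionTorus 2 L))) (Finset (Orb (FermionTorus 2 L))) ℂ)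
    {ι : Type*} (t' : Finset ι)
    (Y Y' : ι → Matrix (Finset (Orb (FermionTorus 2 L))) (Finset (Orb (FermionTorus 2 L))) ℂ)
    (a a' : ι → Fin 4)
    {P R : Matrix (Finset (Orb (FermionTorus 2 L))) (Finset (Orb (FermionTorus 2 L))) ℂ} {δ : ℝ}
    (hP : ∀ φ : Fock (Orb (FermionTorus 2 L)), IsNParticle (L ^ 2) φ →
      hubbardTorus 2 L t U *ᵥ φ =
        ((groundEnergyAt (fermionTorusGraph 2 L) t U (L ^ 2) : ℝ) : ℂ) • φ →
      0 ≤ (star φ ⬝ᵥ P *ᵥ φ).re)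
    (hR : (R + (δ : ℂ) • (1 : Matrix (Finset (Orb (FermionTorus 2 L))) _ ℂ)).PosSemidef) {c : ℝ}
    (hcert : hubbardTorus 2 L t U - (c : ℂ) • 1 =
      gramForm Λm O + (∑ k ∈ s, (hubbardTorus 2 L t U * X k - X k * hubbardTorus 2 L t U) +
        ∑ q ∈ t', (Y q * singletSectorAnn (L ^ 2) (a q) + singletSectorAnn (L ^ 2) (a' q) * Y' q)) +
        (P + R)) :
    c - δ ≤ groundEnergyAt (fermionTorusGraph 2 L) t U (L ^ 2) := by
  classical
  obtain ⟨ψ, hψK, h1, hHψ, hS, -, -⟩ :=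
    LiebHalfFilled.hubbardTorus_exists_unit_groundState (L := L) hL ht hU
  have hN : IsNParticle (L ^ 2) ψ := ((mem_szSector_iff _ _ _).1 hψK).1
  have hHψ' : hubbardTorus 2 L t U *ᵥ ψ =
      ((groundEnergyAt (fermionTorusGraph 2 L) t U (L ^ 2) : ℝ) : ℂ) • ψ := hHψ
  have hpos : ∀ z, 0 ≤ srState ψ (star z * z) := fun z => vectorState_nonneg ψ z
  have hone : srState ψ 1 = 1 := by rw [srState_apply, one_mulVec, h1]
  have hn := srState_null_eq_zero L hN hS hHψ' s X t' Y Y' a a'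
  have hPre : 0 ≤ (srState ψ P).re := by
    rw [srState_apply]
    exact hP ψ hN hHψ'
  have hRre := re_srState_ge_of_posSemidef_add h1 hR
  have hr : -δ ≤ (srState ψ (P + R)).re := by
    simp only [map_add, Complex.add_re]
    linarith
  have h := le_re_map_of_certificate_residual (srState ψ) hpos hone hΛ O hn hr hcert
  rwa [srState_apply, hHψ', dotProduct_smul, h1, smul_eq_mul, mul_one, Complex.ofReal_re] at h

/-- **Observable window row, abstract ground-state-nonnegative term (R2 master at `n = 1`).** With an
energy window `μ (E_up − H) + ν (H − E_lo)`, `μ, ν ≥ 0`, `E_lo ≤ E₀(L²) ≤ E_up` (certified bounds), the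
null terms of `LiebGramRows`, a residual `R + δ·1 ⪰ 0` and ANY `P` with nonnegative expectation in every
half-filled eigenvector at the ground energy, an identity for `V − c·1` proves `c − δ ≤ Re ⟨ψ, V ψ⟩` for
every normalised `(L², S^z = 0)` sector ground state `ψ` (at half filling: THE ground state).
[cite: LiebPRL1989, proof of Theorem 2] [cite: WangEtAl2024, §3 eq. (4)] [cite: KullEtAl2024, §5.3] -/
theorem re_expect_halfFilledGS_ge_of_windowCertificate_gsNonneg (hL : Even L) {t U : ℝ}
    (ht : t ≠ 0) (hU : 0 < U) {Λm : Matrix m m ℂ} (hΛ : Λm.PosSemidef)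
    (O : m → Matrix (Finset (Orb (FermionTorus 2 L))) (Finset (Orb (FermionTorus 2 L))) ℂ)
    {κ : Type*} (s : Finset κ)
    (X : κ → Matrix (Finset (Orb (FermionTorus 2 L))) (Finset (Orb (FermionTorus 2 L))) ℂ)
    {ι : Type*} (t' : Finset ι)
    (Y Y' : ι → Matrix (Finset (Orb (FermionTorus 2 L))) (Finset (Orb (FermionTorus 2 L))) ℂ)
    (a a' : ι → Fin 4)
    {P R : Matrix (Finset (Orb (FermionTorus 2 L))) (Finset (Orb (FermionTorus 2 L))) ℂ} {δ : ℝ}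
    (hP : ∀ φ : Fock (Orb (FermionTorus 2 L)), IsNParticle (L ^ 2) φ →
      hubbardTorus 2 L t U *ᵥ φ =
        ((groundEnergyAt (fermionTorusGraph 2 L) t U (L ^ 2) : ℝ) : ℂ) • φ →
      0 ≤ (star φ ⬝ᵥ P *ᵥ φ).re)
    (hR : (R + (δ : ℂ) • (1 : Matrix (Finset (Orb (FermionTorus 2 L))) _ ℂ)).PosSemidef)
    {V : Matrix (Finset (Orb (FermionTorus 2 L))) (Finset (Orb (FermionTorus 2 L))) ℂ}
    {Eup Elo μ ν c : ℝ} (hμ : 0 ≤ μ) (hν : 0 ≤ ν)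
    (hup : groundEnergyAt (fermionTorusGraph 2 L) t U (L ^ 2) ≤ Eup)
    (hlo : Elo ≤ groundEnergyAt (fermionTorusGraph 2 L) t U (L ^ 2))
    (hcert : V - (c : ℂ) • 1 =
      gramForm Λm O + (∑ k ∈ s, (hubbardTorus 2 L t U * X k - X k * hubbardTorus 2 L t U) +
        ∑ q ∈ t', (Y q * singletSectorAnn (L ^ 2) (a q) + singletSectorAnn (L ^ 2) (a' q) * Y' q)) +
        ((μ : ℂ) • ((Eup : ℂ) • 1 - hubbardTorus 2 L t U) +
          (ν : ℂ) • (hubbardTorus 2 L t U - (Elo : ℂ) • 1) + (P + R))) :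
    ∀ ψ : Fock (Orb (FermionTorus 2 L)), star ψ ⬝ᵥ ψ = 1 →
      IsGroundStateInSector (hubbardTorus 2 L t U) (L ^ 2) 0 ψ →
      c - δ ≤ (star ψ ⬝ᵥ V *ᵥ ψ).re := by
  classical
  intro ψ h1 hgs
  obtain ⟨hN, hHψ⟩ := halfFilled_sectorGS_eigen L hL t U hgs
  have hS := spinSq_mulVec_eq_zero_of_halfFilled_eigen L hL ht hU hN hHψ
  have hpos : ∀ z, 0 ≤ srState ψ (star z * z) := fun z => vectorState_nonneg ψ z
  have hone : srState ψ 1 = 1 := by rw [srState_apply, one_mulVec, h1]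
  have hn := srState_null_eq_zero L hN hS hHψ s X t' Y Y' a a'
  have hPre : 0 ≤ (srState ψ P).re := by
    rw [srState_apply]
    exact hP ψ hN hHψ
  have hRre := re_srState_ge_of_posSemidef_add h1 hR
  set E₀ : ℝ := groundEnergyAt (fermionTorusGraph 2 L) t U (L ^ 2) with hE₀
  have hH : srState ψ (hubbardTorus 2 L t U) = (E₀ : ℂ) := by
    rw [srState_apply, hHψ, dotProduct_smul, h1, smul_eq_mul, mul_one]
  have hwin1 : (srState ψ ((μ : ℂ) • ((Eup : ℂ) • 1 - hubbardTorus 2 L t U))).re =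
      μ * (Eup - E₀) := by
    rw [map_smul, map_sub, map_smul, hone, hH, smul_eq_mul, smul_eq_mul, mul_one,
      ← Complex.ofReal_sub, ← Complex.ofReal_mul, Complex.ofReal_re]
  have hwin2 : (srState ψ ((ν : ℂ) • (hubbardTorus 2 L t U - (Elo : ℂ) • 1))).re =
      ν * (E₀ - Elo) := by
    rw [map_smul, map_sub, map_smul, hone, hH, smul_eq_mul, smul_eq_mul, mul_one,
      ← Complex.ofReal_sub, ← Complex.ofReal_mul, Complex.ofReal_re]
  have hw1 : 0 ≤ μ * (Eup - E₀) := mul_nonneg hμ (sub_nonneg.2 hup)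
  have hw2 : 0 ≤ ν * (E₀ - Elo) := mul_nonneg hν (sub_nonneg.2 hlo)
  have hr : -δ ≤ (srState ψ ((μ : ℂ) • ((Eup : ℂ) • 1 - hubbardTorus 2 L t U) +
      (ν : ℂ) • (hubbardTorus 2 L t U - (Elo : ℂ) • 1) + (P + R))).re := by
    simp only [map_add, Complex.add_re]
    rw [hwin1, hwin2]
    linarith
  have h := le_re_map_of_certificate_residual (srState ψ) hpos hone hΛ O hn hr hcert
  rwa [srState_apply] at h

/-! ## §3 Energy rows with sign-rule terms (R1) -/

/-- **Energy row with sign-rule terms (R1 at `n = 1`)**: `H − c·1 = SOS + null + (Σ_r ν_r (ε_{x_r} ε_{y_r})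
• 𝐒_{x_r}·𝐒_{y_r} + R)`, `ν_r ≥ 0`, `R + δ·1 ⪰ 0` ⟹ `c − δ ≤ E₀(L²)`.
[cite: ShenQiuTian1994, Theorem and eqs. (7)–(9)] [cite: LiebPRL1989, proof of Theorem 2] [cite: Han2020Bootstrap, §2 eq. (3)] -/
theorem groundEnergyAt_halfFilling_ge_of_certificate_signRule (hL : Even L) {t U : ℝ} (ht : t ≠ 0)
    (hU : 0 < U) {Λm : Matrix m m ℂ} (hΛ : Λm.PosSemidef)
    (O : m → Matrix (Finset (Orb (FermionTorus 2 L))) (Finset (Orb (FermionTorus 2 L))) ℂ)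
    {κ : Type*} (s : Finset κ)
    (X : κ → Matrix (Finset (Orb (FermionTorus 2 L))) (Finset (Orb (FermionTorus 2 L))) ℂ)
    {ι : Type*} (t' : Finset ι)
    (Y Y' : ι → Matrix (Finset (Orb (FermionTorus 2 L))) (Finset (Orb (FermionTorus 2 L))) ℂ)
    (a a' : ι → Fin 4)
    {ρ : Type*} (sr : Finset ρ) {νs : ρ → ℝ} (hνs : ∀ r ∈ sr, 0 ≤ νs r)
    (x y : ρ → FermionTorus 2 L)
    {R : Matrix (Finset (Orb (FermionTorus 2 L))) (Finset (Orb (FermionTorus 2 L))) ℂ} {δ : ℝ}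
    (hR : (R + (δ : ℂ) • (1 : Matrix (Finset (Orb (FermionTorus 2 L))) _ ℂ)).PosSemidef) {c : ℝ}
    (hcert : hubbardTorus 2 L t U - (c : ℂ) • 1 =
      gramForm Λm O + (∑ k ∈ s, (hubbardTorus 2 L t U * X k - X k * hubbardTorus 2 L t U) +
        ∑ q ∈ t', (Y q * singletSectorAnn (L ^ 2) (a q) + singletSectorAnn (L ^ 2) (a' q) * Y' q)) +
        (∑ r ∈ sr, ((νs r : ℝ) : ℂ) •
            ((torusSign (x r) * torusSign (y r)) • fermionSpinDot (x r) (y r)) + R)) :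
    c - δ ≤ groundEnergyAt (fermionTorusGraph 2 L) t U (L ^ 2) :=
  groundEnergyAt_halfFilling_ge_of_certificate_gsNonneg L hL ht hU hΛ O s X t' Y Y' a a'
    (fun _ hN hHφ => hubbardTorus_re_expect_signRuleSum_nonneg L hL ht hU hN hHφ sr hνs x y) hR hcert

/-- **Energy row with Lieb Gram blocks AND sign-rule terms (R1 at `n = 1`)**.
[cite: LiebPRL1989, proof of Theorem 2] [cite: ShenQiuTian1994, Theorem and eqs. (7)–(9)] [cite: KullEtAl2024, §5.3] -/
theorem groundEnergyAt_halfFilling_ge_of_certificate_liebGram_signRule (hL : Even L) {t U : ℝ}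
    (ht : t ≠ 0) (hU : 0 < U) {Λm : Matrix m m ℂ} (hΛ : Λm.PosSemidef)
    (O : m → Matrix (Finset (Orb (FermionTorus 2 L))) (Finset (Orb (FermionTorus 2 L))) ℂ)
    {κ : Type*} (s : Finset κ)
    (X : κ → Matrix (Finset (Orb (FermionTorus 2 L))) (Finset (Orb (FermionTorus 2 L))) ℂ)
    {ι : Type*} (t' : Finset ι)
    (Y Y' : ι → Matrix (Finset (Orb (FermionTorus 2 L))) (Finset (Orb (FermionTorus 2 L))) ℂ)
    (a a' : ι → Fin 4)
    {κ₁ : Type*} [Fintype κ₁] {Gm : Matrix κ₁ κ₁ ℂ} (hGm : Gm.PosSemidef)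
    (w : κ₁ → List (FermionTorus 2 L × FermionTorus 2 L))
    {κ₂ : Type*} [Fintype κ₂] {Gm' : Matrix κ₂ κ₂ ℂ} (hGm' : Gm'.PosSemidef)
    (w' : κ₂ → List (FermionTorus 2 L × FermionTorus 2 L))
    {ρ : Type*} (sr : Finset ρ) {νs : ρ → ℝ} (hνs : ∀ r ∈ sr, 0 ≤ νs r)
    (x y : ρ → FermionTorus 2 L)
    {R : Matrix (Finset (Orb (FermionTorus 2 L))) (Finset (Orb (FermionTorus 2 L))) ℂ} {δ : ℝ}
    (hR : (R + (δ : ℂ) • (1 : Matrix (Finset (Orb (FermionTorus 2 L))) _ ℂ)).PosSemidef) {c : ℝ}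
    (hcert : hubbardTorus 2 L t U - (c : ℂ) • 1 =
      gramForm Λm O + (∑ k ∈ s, (hubbardTorus 2 L t U * X k - X k * hubbardTorus 2 L t U) +
        ∑ q ∈ t', (Y q * singletSectorAnn (L ^ 2) (a q) + singletSectorAnn (L ^ 2) (a' q) * Y' q)) +
        (liebForm torusSign Gm w + liebFormFlip torusSign Gm' w' +
          ∑ r ∈ sr, ((νs r : ℝ) : ℂ) •
            ((torusSign (x r) * torusSign (y r)) • fermionSpinDot (x r) (y r)) + R)) :
    c - δ ≤ groundEnergyAt (fermionTorusGraph 2 L) t U (L ^ 2) :=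
  groundEnergyAt_halfFilling_ge_of_certificate_gsNonneg L hL ht hU hΛ O s X t' Y Y' a a'
    (fun _ hN hHφ => hubbardTorus_re_expect_liebForms_add_signRuleSum_nonneg L hL ht hU hN hHφ
      hGm w hGm' w' sr hνs x y) hR hcert

end Torus

end Summit.Ventures.CertifiedManyBodySolver

end
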